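import Summits.QuantumFields.BalabanUV.T4Continuum.Support.VariationalVectorEndOfLeavesMin
import Summits.QuantumFields.BalabanUV.T4Continuum.Support.VariationalAssemblySliceMinFlat
import Summits.QuantumFields.BalabanUV.T4Continuum.Support.VariationalVectorGaugeSliceUB
import Summits.QuantumFields.BalabanUV.T4Continuum.Support.VariationalVectorGaugeSliceFED
import Summits.QuantumFields.BalabanUV.T4Continuum.Support.VariationalVectorRegularityFlat
import Summits.QuantumFields.BalabanUV.T4Continuum.Support.VariationalVectorEndFlat

/-!
# T⁴ programme, spine node NE2 (U1a), lane P2 — THE VECTOR END AT `U = 1`: MODULO LEAF V-REG ONLY (`towerLimitRate_effV_flat_min`), and — with leaf-03-g5's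
# `hREG_flat_closed` — WITH NO DISPLAYED LEAF AT ALL (`towerLimitRate_effV_flat_closed`, `effV_flat_limit`) (model level = the free field; cell `pub-balaban`)

NE2 formalisation swarm `b2b-balaban-t4-ne2-formalise-*`, leaf prover 10 GEN 3 (`prover-b2b-balaban-t4-ne2-formalise-leaf-10-g3-0`, lineage V-COMP TOWER ∕ V-END);
journal «MINE» + INTENT CLAIMS.log 2026-08-20 15:50Z l.16551 (answering leaf-01-g7's OFFER l.16452 ∕ NOTE l.16520; GO to leaf-03-g5's (H) on p224030).  CREDIT: §1 is
leaf-01-g7's draft `HOME/b2b-balaban-t4-ne2-formalise-leaf-01/g7/VariationalVectorEndFlatMin.v0.draft.lean` (itself the twin of this lineage's `VariationalVectorEndFlat`,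
p224030), adopted; §2–§3 are this seat's.  Pure composition of landed modules BY NAME; nothing defined.

§1 **`towerLimitRate_effV_flat_min`** — the twin of `VariationalVectorEndFlat.towerLimitRate_effV_flat` (p224030: U = 1 END modulo V-ONE and V-REG) over the localised END
`VariationalVectorEndOfLeavesMin.towerLimitRate_effV_of_leaves_min`: the V-ONE socket in its (ONE-min) form IS INHABITED at flat data by leaf-01-g7's
`VariationalAssemblySliceMinFlat.hONEm_tower` (leaf-01-g6's flat competitor p220658 + leaf-09-g7's `slice_flat` p222324 one level up), with `ρV k := rhoV (L^k) M 1`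
(V-ONE-1F's regularity functional, p219670), `ε₁ k := 4(d+26)·L∕(L^k)²`, `δ′ k := 0`; the other sockets exactly as in p224030 (leaf-09-g7's `hGm_flat` ∕ `hG_flat` ∕ `hGtr_flat` ∕
`hRtr_flat` ∕ `hTcomp_flat` ∕ `hPc_tower` ∕ `hPf_tower` (p222627), `hUBc_tower` ∕ `hUBf_tower` (p223319), `hFEDcurl_tower` (p223421), leaf-01-g7's `hsliceMin_tower`, this lineage's
`norm_one_le`) — BY NAME.  For `1 ≤ d`, `0 < a`, a rate `θ` with `(L⁻¹)² ≤ θ < 1`, and the ONE displayed leaf V-REG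
`hREG : ∀ k φ W, Q W = φ → (W minimises ScV 1 (Gk k) on the fibre) → rhoV (L^k) M 1 W ≤ C_R k·(ScV 1 (Gk k) W + nsqV φ)`, `0 ≤ C_R k ≤ C_R⋆`:
`TowerLimitRate 1 1 (k ↦ effV (L^k) M 1 (Gmk L M k) (QmL (L^k) M 1) a) (eV Λ⋆ C_P⋆ 0 + ePV Λ⋆ C_P⋆ C_R⋆ (4(d+26)L) 0) θ`, `Λ⋆ = lamV d 0 d 0`, `C_P⋆ = (d+1)·Cst(d,1)`.

§2 **`towerLimitRate_effV_flat_closed`** — §1 with its `hREG` socket DISCHARGED by leaf-03-g5's `VariationalVectorRegularityFlat.hREG_flat_closed` (V-REG at `U = 1` for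
Bałaban's `projG 1 (ker Q′_1)`, the one operator inequality `‖∂·PcT·∂ᴴ‖ ≤ BXp(d,1)²σ₀(d,1)⁻²` supplied from the substrate cell's `CTGaugeTerm`; V-UB fed by `hUBc_tower`), k-UNIFORM
constant `C_R⋆ := 8·lamV d 0 d 0 + 8·(BXp(d,1)²·σ₀(d,1)⁻²)²·((d+1)·Cst(d,1))` (the constant of leaf-03-g5's (H) `towerLimitRate_effV_flat_reg`).  DISPLAYED: NOTHING but the data
`1 ≤ d`, `0 < a`, `(L⁻¹)² ≤ θ < 1` (so `L ≥ 2`), the torus `M`.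
§3 **`effV_flat_limit`** — §2 at the sharpest admissible rate `θ = (L⁻¹)²`, UNPACKED (`avgTow 1 1 X k = X k`, `eV Λ C_P 0 = 0`, `ePV Λ C_P C_R c_ε 0 = c_ε·C_R·(Λ+1)`): for `1 ≤ d`,
`2 ≤ L`, `0 < a` there is `K∞ : Matrix (Tor M × Fin d) (Tor M × Fin d) ℂ` with `effV (L^k) M 1 (Gmk L M k) (QmL (L^k) M 1) a ⟶ K∞` and
`‖effV (L^k) M 1 (Gmk L M k) (QmL (L^k) M 1) a − K∞‖ ≤ 4(d+26)·L·C_R⋆·(Λ⋆+1)·(L⁻²)^k ∕ (1 − L⁻²)` for every `k` (`ℓ²`-operator norm on the unit torus `M`).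
I.e. AT `U = 1` (the free field) THE VECTOR END OF ROAD P2 IS A THEOREM OF THE TREE: the effective quadratic 1-form actions of the flat line-sum averages along `n_k = L^k`,
with Bałaban's gauge functional `n⁻²·∂(I−P)∂ᴴ` (leaf-09-g7's `GmFlat`), converge on the unit torus at rate `L^{−2k}` with a constant depending on `d` and `L` only.  Physically
trivial (no background field, `E = ℂ`); structurally it is the NON-VACUITY CERTIFICATE of every socket of the END route (V-UB, V-P, V-FED, (SLICE-min), (ONE-min), V-REG are all
kernel theorems at flat data) — and it says nothing about the END WITH BACKGROUND, where (SLICE-min) (leaf-01-g7's memo `t4/T4-EST-NE2-P2-VGF.md`) and the decay of the small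
parameters are OPEN.

HONEST FRAMING (T4-DAG p. 1).  [folklore] composition of landed model-level modules; flat data = the free field; nothing printed is a hypothesis; no `def`, no `def … : Prop`,
no `sorry`; axioms standard.  No leaf WITH BACKGROUND is discharged; V-GF with background OPEN; V-END ∕ NE2 NOT proved; NE3 OPEN; spine PROVED 0∕9 unchanged; rung (B)+1 on a
fixed finite T⁴ — NOT infinite volume, NOT mass gap, NOT Clay.  HONEST DEPENDENCY (cell, verbatim): continuum YM on T⁴ ⇐ BetaPertH ∧ nine spine estimates (0/9 proved);
BetaPertH ⇐ (D1) ∧ (D4) ∧ CAP+tail; G-an2-4 gates asym, D1 and NE2/3/4.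
-/

noncomputable section

namespace Summit.QuantumFields.BalabanUV.T4Continuum.VariationalVectorEndFlatMin

open Finset Filter
open scoped Matrix ComplexConjugate ComplexOrder Matrix.Norms.L2Operator Topology
open Literature.MathematicalPhysics.QuantumFieldTheory.Balaban1983to89.B5Prop11Plancherel (Tor fine Cst Cst_nonneg)
open Summit.QuantumFields.BalabanUV.T4Continuum.VariationalTransfer (blockSpin)
open Summit.QuantumFields.BalabanUV.T4Continuum.CovariantAveragingTower (TowerLimitRate Atow Atow_succ avgTow)
open Summit.QuantumFields.BalabanUV.T4Continuum.VectorBlockTrialForm (nsqV QvL)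
open Summit.QuantumFields.BalabanUV.T4Continuum.VariationalVectorForm (ScV SfV qWV lamV lamV_nonneg)
open Summit.QuantumFields.BalabanUV.T4Continuum.VariationalVectorEffective (unc effV)
open Summit.QuantumFields.BalabanUV.T4Continuum.VariationalVectorTower (QmL)
open Summit.QuantumFields.BalabanUV.T4Continuum.VariationalVectorEndOfLeaves (eV ePV)
open Summit.QuantumFields.BalabanUV.T4Continuum.VariationalVectorEndOfLeavesMin (towerLimitRate_effV_of_leaves_min)
open Summit.QuantumFields.BalabanUV.T4Continuum.VariationalVectorGaugeSliceB5 (flatR)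
open Summit.QuantumFields.BalabanUV.T4Continuum.VariationalVectorGaugeSliceTower
  (Gk Gk' Gmk hGm_flat hG_flat hGtr_flat hRtr_flat hTcomp_flat hPc_tower hPf_tower)
open Summit.QuantumFields.BalabanUV.T4Continuum.VariationalVectorGaugeSliceUB (hUBc_tower hUBf_tower)
open Summit.QuantumFields.BalabanUV.T4Continuum.VariationalVectorGaugeSliceFED (hFEDcurl_tower)
open Summit.QuantumFields.BalabanUV.T4Continuum.VariationalVectorEndFlat (norm_one_le)
open Summit.QuantumFields.BalabanUV.T4Continuum.VariationalVectorOneStepPhys (rhoV rhoV_nonneg)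
open Summit.QuantumFields.BalabanUV.T4Continuum.VariationalAssemblySliceMinFlat (hsliceMin_tower hONEm_tower)
open Summit.QuantumFields.BalabanUV.T4Continuum.VariationalVectorRegularityFlat (hREG_flat_closed)
open Summit.QuantumFields.BalabanUV.T4Continuum.CTGaugeTerm (BXp)
open Summit.QuantumFields.BalabanUV.T4Continuum.ScalarAveragedCompression (sigma0)

variable {d : ℕ} (L : ℕ) [NeZero L] (M : Fin d → ℕ) [hM : ∀ μ, NeZero (M μ)]

/-! ## §1 The `U = 1` END modulo V-REG only (leaf-01-g7's draft, adopted) -/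

omit hM in
/-- the V-ONE small parameter at flat data decays at rate `(L⁻¹)²`, hence at every rate `θ ≥ (L⁻¹)²`: `4(d+26)·L∕(L^k)² ≤ 4(d+26)L·θ^k`. [folklore] -/
theorem eps1_flat_le {θ : ℝ} (hθL : ((L : ℝ)⁻¹) ^ 2 ≤ θ) (k : ℕ) :
    4 * ((d : ℝ) + 26) * ((L : ℝ) / ((L ^ k : ℕ) : ℝ) ^ 2) ≤ (4 * ((d : ℝ) + 26) * L) * θ ^ k := by
  have hL : (0 : ℝ) < L := by exact_mod_cast Nat.pos_of_ne_zero (NeZero.ne L)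
  have h0 : (0 : ℝ) ≤ ((L : ℝ)⁻¹) ^ 2 := by positivity
  have e : ((L : ℝ) / ((L ^ k : ℕ) : ℝ) ^ 2) = (L : ℝ) * (((L : ℝ)⁻¹) ^ 2) ^ k := by
    push_cast; ring
  rw [e, ← mul_assoc]
  exact mul_le_mul_of_nonneg_left (pow_le_pow_left₀ h0 hθL k) (by positivity)

/-- **THE VECTOR END AT `U = 1` MODULO LEAF V-REG ONLY.**  Flat data along `n_k = L^k`, Bałaban's gauge functional `G k = projG 1 (ker Q′_1)` (leaf-09-g7's `Gk`); every
socket of the localised END `towerLimitRate_effV_of_leaves_min` but V-REG discharged BY NAME — in particular leaf V-ONE by leaf-01-g7's `hONEm_tower` with `ρV k = rhoV (L^k) M 1`,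
`ε₁ k = 4(d+26)L∕(L^k)²`, `δ′ k = 0`; DISPLAYED: V-REG for `rhoV` at the fibre minimisers (`hREG`, `0 ≤ C_R k ≤ C_R⋆`).  THEN, for every rate `θ` with `(L⁻¹)² ≤ θ < 1`,
`TowerLimitRate 1 1 (k ↦ effV (L^k) M 1 (Gmk L M k) (QmL (L^k) M 1) a) (eV Λ⋆ C_P⋆ 0 + ePV Λ⋆ C_P⋆ C_R⋆ (4(d+26)L) 0) θ`. (Proof: leaf-01-g7's draft, adopted.) [folklore] -/
theorem towerLimitRate_effV_flat_min (hd : 1 ≤ d) {a : ℝ} (ha : 0 < a) (CR : ℕ → ℝ) {CRs θ : ℝ}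
    (hCR : ∀ k, 0 ≤ CR k) (hCRs : ∀ k, CR k ≤ CRs) (hθL : ((L : ℝ)⁻¹) ^ 2 ≤ θ) (hθ1 : θ < 1)
    (hREG : ∀ k (φ : Tor M → Fin d → ℂ) W, QvL (L ^ k) M (fun _ _ _ _ => (1 : ℂ →L[ℂ] ℂ)) W = φ →
      (∀ W₂, QvL (L ^ k) M (fun _ _ _ _ => (1 : ℂ →L[ℂ] ℂ)) W₂ = φ →
        ScV (L ^ k) M (flatR (L ^ k) M) (Gk L M k) W ≤ ScV (L ^ k) M (flatR (L ^ k) M) (Gk L M k) W₂) →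
      rhoV (L ^ k) M (flatR (L ^ k) M) W ≤ CR k * (ScV (L ^ k) M (flatR (L ^ k) M) (Gk L M k) W + nsqV M φ)) :
    TowerLimitRate (ι := fun _ => Tor M × Fin d) (fun _ => (1 : Matrix (Tor M × Fin d) (Tor M × Fin d) ℂ)) 1
      (fun k => effV (L ^ k) M (flatR (L ^ k) M) (Gmk L M k) (QmL (L ^ k) M (fun _ _ _ _ => (1 : ℂ →L[ℂ] ℂ))) a)
      (eV (lamV d 0 d 0) (((d : ℝ) + 1) * Cst d 1) 0 + ePV (lamV d 0 d 0) (((d : ℝ) + 1) * Cst d 1) CRs (4 * ((d : ℝ) + 26) * L) 0) θ := by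
  have hΛ0 : 0 ≤ lamV d 0 d 0 := lamV_nonneg (Nat.cast_nonneg d) le_rfl
  have hCP0 : 0 ≤ ((d : ℝ) + 1) * Cst d 1 := by have := Cst_nonneg d 1; positivity
  have hθ : 0 ≤ θ := le_trans (by positivity) hθL
  have h := towerLimitRate_effV_of_leaves_min L M (fun k => flatR (L ^ k) M) (fun k => flatR L (fine (L ^ k) M)) (Gmk L M) (Gk L M) (Gk' L M)
    (fun k => fun _ _ _ _ => (1 : ℂ →L[ℂ] ℂ)) (fun k => fun _ _ _ _ => (1 : ℂ →L[ℂ] ℂ))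
    (hGm_flat L M) (hG_flat L M) (hTcomp_flat L M) (hRtr_flat L M) (hGtr_flat L M) (fun _ _ _ _ _ => norm_one_le) ha
    (fun _ => lamV d 0 d 0) (fun _ => ((d : ℝ) + 1) * Cst d 1) CR (fun _ => 0) (fun k => 4 * ((d : ℝ) + 26) * ((L : ℝ) / ((L ^ k : ℕ) : ℝ) ^ 2))
    (fun _ => 0) (fun _ => 0) (fun _ => 0)
    (Λs := lamV d 0 d 0) (CPs := ((d : ℝ) + 1) * Cst d 1) (CRs := CRs) (cδ := 0) (cε := 4 * ((d : ℝ) + 26) * L) (cδ' := 0) (cσ := 0) (cσ' := 0) (θ := θ)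
    (fun _ => hΛ0) (fun _ => le_rfl) (fun _ => hCP0) (fun _ => le_rfl) hCR hCRs
    (fun _ => le_rfl) (fun _ => by positivity) (fun _ => le_rfl) (fun _ => le_rfl) (fun _ => le_rfl) hθ hθ1
    (fun _ => by rw [zero_mul]) (eps1_flat_le L hθL) (fun _ => by rw [zero_mul]) (fun _ => by rw [zero_mul]) (fun _ => by rw [zero_mul])
    (ρV := fun k => rhoV (L ^ k) M (flatR (L ^ k) M)) (fun k W => rhoV_nonneg (L ^ k) M _ W)
    (hUBc_tower L M hd) (hUBf_tower L M hd) (hPc_tower L M) (hPf_tower L M) (hFEDcurl_tower L M) (hsliceMin_tower L M) (hONEm_tower L M) hREG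
  have e : eV (lamV d 0 d 0) (((d : ℝ) + 1) * Cst d 1) 0 + 0 * (lamV d 0 d 0 + eV (lamV d 0 d 0) (((d : ℝ) + 1) * Cst d 1) 0)
      + 0 * ((((d : ℝ) + 1) * Cst d 1) * (lamV d 0 d 0 + 1)) + ePV (lamV d 0 d 0) (((d : ℝ) + 1) * Cst d 1) CRs (4 * ((d : ℝ) + 26) * L) 0
      = eV (lamV d 0 d 0) (((d : ℝ) + 1) * Cst d 1) 0 + ePV (lamV d 0 d 0) (((d : ℝ) + 1) * Cst d 1) CRs (4 * ((d : ℝ) + 26) * L) 0 := by ring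
  rw [e] at h
  exact h

/-! ## §2 The `U = 1` END with NO displayed leaf -/

/-- **THE VECTOR END AT `U = 1`, CLOSED.**  §1 with its V-REG socket DISCHARGED by leaf-03-g5's `hREG_flat_closed` (fed by leaf-09-g7's `hUBc_tower`), k-uniform constant
`C_R⋆ := 8·lamV d 0 d 0 + 8·(BXp(d,1)²·σ₀(d,1)⁻²)²·((d+1)·Cst(d,1))`.  DISPLAYED: only the data `1 ≤ d`, `0 < a`, `(L⁻¹)² ≤ θ < 1`.  THEN
`TowerLimitRate 1 1 (k ↦ effV (L^k) M 1 (Gmk L M k) (QmL (L^k) M 1) a) (eV Λ⋆ C_P⋆ 0 + ePV Λ⋆ C_P⋆ C_R⋆ (4(d+26)L) 0) θ`.  Free field only; nothing with background. [folklore] -/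
theorem towerLimitRate_effV_flat_closed (hd : 1 ≤ d) {a : ℝ} (ha : 0 < a) {θ : ℝ} (hθL : ((L : ℝ)⁻¹) ^ 2 ≤ θ) (hθ1 : θ < 1) :
    TowerLimitRate (ι := fun _ => Tor M × Fin d) (fun _ => (1 : Matrix (Tor M × Fin d) (Tor M × Fin d) ℂ)) 1
      (fun k => effV (L ^ k) M (flatR (L ^ k) M) (Gmk L M k) (QmL (L ^ k) M (fun _ _ _ _ => (1 : ℂ →L[ℂ] ℂ))) a)
      (eV (lamV d 0 d 0) (((d : ℝ) + 1) * Cst d 1) 0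
        + ePV (lamV d 0 d 0) (((d : ℝ) + 1) * Cst d 1)
            (8 * lamV d 0 d 0 + 8 * (BXp d 1 ^ 2 * ((sigma0 d 1) ^ 2)⁻¹) ^ 2 * ((d + 1 : ℝ) * Cst d 1)) (4 * ((d : ℝ) + 26) * L) 0) θ := by
  have hΛ0 : 0 ≤ lamV d 0 d 0 := lamV_nonneg (Nat.cast_nonneg d) le_rfl
  have hCR0 : 0 ≤ 8 * lamV d 0 d 0 + 8 * (BXp d 1 ^ 2 * ((sigma0 d 1) ^ 2)⁻¹) ^ 2 * ((d + 1 : ℝ) * Cst d 1) := by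
    have := Cst_nonneg d 1; positivity
  exact towerLimitRate_effV_flat_min L M hd ha (fun _ => 8 * lamV d 0 d 0 + 8 * (BXp d 1 ^ 2 * ((sigma0 d 1) ^ 2)⁻¹) ^ 2 * ((d + 1 : ℝ) * Cst d 1))
    (fun _ => hCR0) (fun _ => le_rfl) hθL hθ1 (fun k => hREG_flat_closed (L ^ k) M hΛ0 (hUBc_tower L M hd k))

/-! ## §3 Unpacked: the limit of the flat effective actions with rate `L^{−2k}` -/

/-- with identity averagings the composite averaging is the identity. [folklore] -/
theorem Atow_const_one {ι₀ : Type*} [Fintype ι₀] [DecidableEq ι₀] (k : ℕ) :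
    Atow (ι := fun _ => ι₀) (fun _ => (1 : Matrix ι₀ ι₀ ℂ)) k = 1 := by
  induction k with
  | zero => rfl
  | succ k ih => rw [Atow_succ, ih, one_mul]

/-- with identity averagings and `r = 1` the unit-lattice image of a tower is the tower itself: `avgTow 1 1 X k = X k`. [folklore] -/
theorem avgTow_const_one {ι₀ : Type*} [Fintype ι₀] [DecidableEq ι₀] (X : ℕ → Matrix ι₀ ι₀ ℂ) (k : ℕ) :
    avgTow (ι := fun _ => ι₀) (fun _ => (1 : Matrix ι₀ ι₀ ℂ)) 1 X k = X k := by
  unfold avgTow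
  rw [Atow_const_one, one_mul, Matrix.conjTranspose_one, mul_one, Complex.ofReal_one, one_pow, one_smul]

omit hM in
/-- the END's constant at `δ = δ′ = 0`: `eV Λ C_P 0 + ePV Λ C_P C_R c_ε 0 = c_ε·C_R·(Λ+1)`. [folklore] -/
theorem eV_add_ePV_zero (Λ CP CR cε : ℝ) : eV Λ CP 0 + ePV Λ CP CR cε 0 = cε * CR * (Λ + 1) := by
  unfold eV ePV; ring

/-- **THE `U = 1` VECTOR END, UNPACKED.**  For `1 ≤ d`, `2 ≤ L`, `0 < a`: the effective quadratic 1-form actions `effV (L^k) M 1 (Gmk L M k) (QmL (L^k) M 1) a` of the flat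
line-sum averages along `n_k = L^k`, with Bałaban's gauge functional `n⁻²·∂(I−P)∂ᴴ`, CONVERGE in `ℓ²`-operator norm on the unit torus `M`, at rate `L^{−2k}`:
`‖effV_k − K∞‖ ≤ 4(d+26)·L·C_R⋆·(lamV d 0 d 0 + 1)·(L⁻²)^k ∕ (1 − L⁻²)`, `C_R⋆ = 8·lamV d 0 d 0 + 8·(BXp(d,1)²σ₀(d,1)⁻²)²·((d+1)·Cst(d,1))`.  No displayed leaf; free field
only (the non-vacuity certificate of the END route's sockets, not a statement with background). [folklore] -/
theorem effV_flat_limit (hd : 1 ≤ d) (hL : 2 ≤ L) {a : ℝ} (ha : 0 < a) :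
    ∃ Klim : Matrix (Tor M × Fin d) (Tor M × Fin d) ℂ,
      Tendsto (fun k => effV (L ^ k) M (flatR (L ^ k) M) (Gmk L M k) (QmL (L ^ k) M (fun _ _ _ _ => (1 : ℂ →L[ℂ] ℂ))) a) atTop (𝓝 Klim) ∧
      ∀ k, ‖effV (L ^ k) M (flatR (L ^ k) M) (Gmk L M k) (QmL (L ^ k) M (fun _ _ _ _ => (1 : ℂ →L[ℂ] ℂ))) a - Klim‖
        ≤ (4 * ((d : ℝ) + 26) * L) * (8 * lamV d 0 d 0 + 8 * (BXp d 1 ^ 2 * ((sigma0 d 1) ^ 2)⁻¹) ^ 2 * ((d + 1 : ℝ) * Cst d 1))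
            * (lamV d 0 d 0 + 1) * (((L : ℝ)⁻¹) ^ 2) ^ k / (1 - ((L : ℝ)⁻¹) ^ 2) := by
  have hL1 : (1 : ℝ) < L := by exact_mod_cast hL
  have hθ1 : ((L : ℝ)⁻¹) ^ 2 < 1 := by
    have h1 : (L : ℝ)⁻¹ < 1 := inv_lt_one_of_one_lt₀ hL1
    have h0 : (0 : ℝ) ≤ (L : ℝ)⁻¹ := by positivity
    nlinarith
  obtain ⟨Klim, hT, hR⟩ := towerLimitRate_effV_flat_closed L M hd ha (θ := ((L : ℝ)⁻¹) ^ 2) le_rfl hθ1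
  refine ⟨Klim, ?_, fun k => ?_⟩
  · have e : avgTow (ι := fun _ => Tor M × Fin d) (fun _ => (1 : Matrix (Tor M × Fin d) (Tor M × Fin d) ℂ)) 1
        (fun k => effV (L ^ k) M (flatR (L ^ k) M) (Gmk L M k) (QmL (L ^ k) M (fun _ _ _ _ => (1 : ℂ →L[ℂ] ℂ))) a)
        = fun k => effV (L ^ k) M (flatR (L ^ k) M) (Gmk L M k) (QmL (L ^ k) M (fun _ _ _ _ => (1 : ℂ →L[ℂ] ℂ))) a :=
      funext fun k => avgTow_const_one _ k
    rw [e] at hT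
    exact hT
  · have h := hR k
    rw [avgTow_const_one, eV_add_ePV_zero] at h
    exact h

/-- the same limit ENTRYWISE (the `ℓ²`-operator-norm topology on matrices over a finite index type is the product topology): for `1 ≤ d`, `2 ≤ L`, `0 < a` there is
`K∞` with `effV (L^k) M 1 (Gmk L M k) (QmL (L^k) M 1) a i j ⟶ K∞ i j` for every pair of unit-torus 1-form indices `i j : Tor M × Fin d`. [folklore] -/
theorem effV_flat_tendsto_entry (hd : 1 ≤ d) (hL : 2 ≤ L) {a : ℝ} (ha : 0 < a) :
    ∃ Klim : Matrix (Tor M × Fin d) (Tor M × Fin d) ℂ, ∀ i j : Tor M × Fin d,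
      Tendsto (fun k => effV (L ^ k) M (flatR (L ^ k) M) (Gmk L M k) (QmL (L ^ k) M (fun _ _ _ _ => (1 : ℂ →L[ℂ] ℂ))) a i j) atTop (𝓝 (Klim i j)) := by
  obtain ⟨Klim, hT, _⟩ := effV_flat_limit L M hd hL ha
  exact ⟨Klim, fun i j => ((continuous_apply j).tendsto _).comp (((continuous_apply i).tendsto _).comp hT)⟩

end Summit.QuantumFields.BalabanUV.T4Continuum.VariationalVectorEndFlatMin

end
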